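import Summits.QuantumFields.YangMills.Theorems.UnitScaleTiltProp7CombTildLinearResponseOfRegPrT3
import Summits.QuantumFields.YangMills.Theorems.UnitScaleTiltProp7CornerCombTwoLevelTransport
import HarnessLib

/-!
# Route `UnitScaleTilt`, crux K1 «MinimiserStabilityRegPr» (stmt-QuantumFields-19200), route-R E′ (A′)-on-Σ, P-A2 (β), row «(n3)-comb» —
# (O2) GROUNDWORK, file F-8c-3a: THE BACKGROUND-TOWER WINDOWS AT THE MEMBER, LEVEL BY LEVEL AND PROPORTIONAL TO THE PLAQUETTE SIZE
# («for `W ∈ RegPr`, the level-`k` averaged background `Ū₀♯ᵏ` has plaquettes `≤ a_k = 4ε₀(Lᵏ∕L^{K−n})²`, block loops `≤ 16(d+1)(d+4)L²·a_k`, next-level bonds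
# `32(d+1)(d+4)L²·a_k`-close to its straight segments — GEOMETRIC FROM THE TOP, never a level-uniform O(ε₀)»)

«(O2) groundwork — not consumed by any displayed row before the freeze lifts» (★★OWNER `ym3-torus-plan` g29∕g30 RULINGS №20 (2), №22; «(II) GO» 06:26∕06:31Z;
PENS ROUND 5 10:02:33Z: F-8c-3 «the level windows at the member» — the background half typed here by the pen-namer, the perturbation half (two-block sups `μ_j`) left to
F-8c-3b).  Cell `ym3-torus`, D-0154 (3c) R3 twin-width seat `ym-routeR-w1` (gen 9).  THEOREMS ONLY (0 `def`, 0 `sorry`); `--supports stmt-QuantumFields-19200 --as helper`,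
count-neutral.  YM₃ on T³ is a ladder rung (R3), not the Clay problem; nothing here claims `hMcomb`, `hMcomb₂`, (β), `hPA2`, `hcoS`, the stub, the crux, d = 4 or the mass gap.

THE POINT (MASTER `DESIGN-N3COMB-LINEAR-CORE-routeRw1g9.md` §1 VERDICT (R4); SPEC F-8 §2 «level windows»).  Every dressed defect of the (II) lane is RELATIVE with a coefficient
`a_k` (plaquettes of `Ū₀♯ᵏ`), `α_k` (block loops) or `δ_k` (next-level bond vs straight segment); the kill line is respected only if these are read PROPORTIONAL to the fine
plaquette size, `a_k = 2·(2ε₀·(Lᵏ·(L^{K−n})⁻¹)²)` — geometric from the top, `Σ_{k ≤ K−n} a_k ≤ 4ε₀∕(1 − L⁻²)`.  ★routeR-w2 ✓`Prop7CombTildLinearResponseOfRegPr` already reads the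
tower data of `W ∈ RegPr` (lit ✓`tower_data_of_regPr` ∘ ✓`B7Eq123General.level_data`, `10⁷L³ε₀ ≤ 1`) as WINDOWS (`U1`, loops `≤ 1∕64`); this file reads the SAME data as COEFFICIENTS,
in the letters the consumers display (✓F-6c-3d `hplaq`∕`hbs`∕`hbU`, ✓F-6c-2b `a`∕`δ`, F-7b `α`):
* `norm_hol_plaqWord_avgIter_pull_sub_one_le_of_regPr` — `hplaq k`: `‖Ū₀♯ᵏ(∂p) − 1‖ ≤ a_k` at EVERY `ℤ³` plaquette;
* `norm_Wcx_avgIter_pull_sub_one_le_level_of_regPr` — `α_k := 2·(8(d+1)(d+4)L²·a_k)` (lit ✓`norm_Wcx_sub_one_le`), and `…_le_level_window` (`α_k ≤ 1∕64`);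
* `norm_avgIter_succ_pull_sub_hol_seg_le_of_regPr` — `hbs k`: `‖Ū₀♯ᵏ⁺¹(z,ν) − Ū₀♯ᵏ([L•z, L•z + L e_ν])‖ ≤ 4·α_k` (✓F-6c-2a `norm_rescale_bavg_sub_hol_seg_le`, lit `avgIter_succ`);
* `bavg_avgIter_pull_mem_U1_of_regPr` — `hbU`: `bavg L Ū₀♯ᵏ (L•z) κ ∈ U1` (= ✓`avgIter_pull_mem_U1_of_regPr` one level up, `avgIter_succ`).
Constants closed in (d = 3, L); the level enters ONLY through `a_k` ((g1)(g2)).  HONEST SCOPE: re-readings of cited rows; the perturbation-side windows (`72μ_j ≤ 1`, two-block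
sups from `In19` + ✓`Prop7CombTowerLevelUnitarity`) are F-8c-3b; the final `obtain` is F-8c-final (routeR-w6 g9).

References: T. Bałaban, CMP **98** (1985) 17–51 [Balaban1985Averaging] ((42)–(47) pp.23–25, (52)–(54) p.26, (65) p.29); CMP **102** (1985) 277–309 [Balaban1985Variational] ((14) p.280).
-/

set_option autoImplicit false

noncomputable section

open scoped Matrix.Norms.L2Operator BigOperators

namespace Summit.QuantumFields.YangMills.Theorems.Prop7CombTowerWindowsOfRegPr

open Literature.MathematicalPhysics.QuantumFieldTheory.Balaban1983to89
open Literature.MathematicalPhysics.QuantumFieldTheory.Balaban1983to89.T3ContinuumYM3Torus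
open T3PrintedRegularMinimiser (RegPr)
open T3SectALandauChart (bgUnits)
open B7Prop1Explicit renaming Site → LSite
open B7Prop1Explicit (e hol seg boxVec Wcx bavg plaqWord U1)
open B7Prop2Explicit (avgIter avgIter_succ rescale_apply pdev le_pdev norm_Wcx_sub_one_le)
open B7Eq123General (level_data)
open B7AvgClosedSpecialUnitarySharp (avgClosed_specialUnitary_of_le_twentyone)
open B10Eq27TorusAxialLog (pull)
open Summit.QuantumFields.YangMills.Theorems.Prop7SPrint (basePt)
open Summit.QuantumFields.YangMills.Theorems.Prop7CombFrameLinearResponseOfRegPr (tower_data_of_regPr)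
open Summit.QuantumFields.YangMills.Theorems.Prop7FrameResponseCombSU2 (windows_of_ten7)
open Summit.QuantumFields.YangMills.Theorems.Prop7CombTildLinearResponseOfRegPr (avgIter_pull_mem_U1_of_regPr)
open Summit.QuantumFields.YangMills.Theorems.Prop7CornerCombTwoLevelTransport (norm_rescale_bavg_sub_hol_seg_le)

variable (F : T3Family) {n K : ℕ}

/-- **THE LEVEL DATA OF THE MEMBER's BACKGROUND TOWER** (lit ✓`level_data` at `α₀ = 2ε₀`): `U1`-valued, plaquette deviation `< a_k`, and `a_k ≤ 1∕(1024(d+1)(d+4)L²)`,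
`a_k = 2·(2ε₀·(Lᵏ·(L^{K−n})⁻¹)²)`. [cite: Balaban1985Averaging, (52)–(54) p.26; Balaban1985Variational, (14) p.280] -/
theorem level_data_of_regPr {ε₀ : ℝ} (hε₀ : 0 < ε₀) (hε : 10 ^ 7 * (F.L : ℝ) ^ 3 * ε₀ ≤ 1)
    (W : GaugeField (F.P K) 0 (Matrix.specialUnitaryGroup (Fin 2) ℂ)) (hreg : RegPr F n K ε₀ W) {k : ℕ} (hk : k ≤ K - n) :
    (∀ x κ, avgIter (F.P K).L (pull (bgUnits F K W) (basePt F n K)) k x κ ∈ U1 (Matrix (Fin 2) (Fin 2) ℂ)) ∧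
      0 ≤ 2 * (2 * ε₀ * ((((F.P K).L : ℝ)) ^ k * ((((F.P K).L : ℝ)) ^ (K - n))⁻¹) ^ 2) ∧
      pdev (avgIter (F.P K).L (pull (bgUnits F K W) (basePt F n K)) k) < 2 * (2 * ε₀ * ((((F.P K).L : ℝ)) ^ k * ((((F.P K).L : ℝ)) ^ (K - n))⁻¹) ^ 2) ∧
      2 * (2 * ε₀ * ((((F.P K).L : ℝ)) ^ k * ((((F.P K).L : ℝ)) ^ (K - n))⁻¹) ^ 2)
        ≤ 1 / (1024 * (((F.P K).d : ℝ) + 1) * (((F.P K).d : ℝ) + 4) * ((F.P K).L : ℝ) ^ 2) := by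
  obtain ⟨hα3, hα4, -, -, -⟩ := windows_of_ten7 F (K := K) hε₀.le hε
  have hL2 : 2 ≤ (F.P K).L := (F.P K).hL.2
  obtain ⟨hU₀, h52⟩ := tower_data_of_regPr hε₀ W hreg (le_refl (K - n))
  have hG := avgClosed_specialUnitary_of_le_twentyone (N := 2) (by norm_num) (F.P K).d (F.P K).L
  have hα : 0 < 2 * ε₀ := by positivity
  exact level_data (F.P K).L hL2 hG (K - n) (pull (bgUnits F K W) (basePt F n K)) hU₀ hα hα3 hα4 h52 k hk

/-- ★ **`hplaq k` — THE PLAQUETTES OF `Ū₀♯ᵏ` ARE WITHIN `a_k` OF `1` AT EVERY `ℤ³` PLAQUETTE**, `a_k = 2·(2ε₀·(Lᵏ·(L^{K−n})⁻¹)²)` (geometric from the top).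
[cite: Balaban1985Averaging, (52)–(54) p.26] -/
theorem norm_hol_plaqWord_avgIter_pull_sub_one_le_of_regPr {ε₀ : ℝ} (hε₀ : 0 < ε₀) (hε : 10 ^ 7 * (F.L : ℝ) ^ 3 * ε₀ ≤ 1)
    (W : GaugeField (F.P K) 0 (Matrix.specialUnitaryGroup (Fin 2) ℂ)) (hreg : RegPr F n K ε₀ W) {k : ℕ} (hk : k ≤ K - n)
    (x : LSite (F.P K).d) (μ ν : Fin (F.P K).d) :
    ‖((hol (avgIter (F.P K).L (pull (bgUnits F K W) (basePt F n K)) k) x (plaqWord μ ν) : (Matrix (Fin 2) (Fin 2) ℂ)ˣ) : Matrix (Fin 2) (Fin 2) ℂ) - 1‖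
      ≤ 2 * (2 * ε₀ * ((((F.P K).L : ℝ)) ^ k * ((((F.P K).L : ℝ)) ^ (K - n))⁻¹) ^ 2) := by
  obtain ⟨hV, -, hpdev, -⟩ := level_data_of_regPr F hε₀ hε W hreg hk
  exact (le_pdev hV x μ ν).trans hpdev.le

/-- ★ **`α_k` — THE BLOCK LOOPS OF `Ū₀♯ᵏ`, PROPORTIONAL TO `a_k`**: `‖W_{c,x_r} − 1‖ ≤ 2·(8(d+1)(d+4)L²·a_k)` at every base point (lit ✓`norm_Wcx_sub_one_le`, (44)∕(47)).
[cite: Balaban1985Averaging, (42)–(47) pp.23–25] -/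
theorem norm_Wcx_avgIter_pull_sub_one_le_level_of_regPr {ε₀ : ℝ} (hε₀ : 0 < ε₀) (hε : 10 ^ 7 * (F.L : ℝ) ^ 3 * ε₀ ≤ 1)
    (W : GaugeField (F.P K) 0 (Matrix.specialUnitaryGroup (Fin 2) ℂ)) (hreg : RegPr F n K ε₀ W) {k : ℕ} (hk : k ≤ K - n)
    (q : LSite (F.P K).d) (κ : Fin (F.P K).d) (r : Fin (F.P K).d → Fin (F.P K).L) :
    ‖((Wcx (F.P K).L (avgIter (F.P K).L (pull (bgUnits F K W) (basePt F n K)) k) q κ (boxVec (F.P K).L r) : (Matrix (Fin 2) (Fin 2) ℂ)ˣ) : Matrix (Fin 2) (Fin 2) ℂ) - 1‖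
      ≤ 2 * (8 * ((F.P K).d + 1) * ((F.P K).d + 4) * ((F.P K).L : ℝ) ^ 2 * (2 * (2 * ε₀ * ((((F.P K).L : ℝ)) ^ k * ((((F.P K).L : ℝ)) ^ (K - n))⁻¹) ^ 2))) := by
  obtain ⟨hV, hαj0, hpdev, hαjle⟩ := level_data_of_regPr F hε₀ hε W hreg hk
  have hL1 : 1 ≤ (F.P K).L := le_trans (by norm_num) (F.P K).hL.2
  set αj : ℝ := 2 * (2 * ε₀ * ((((F.P K).L : ℝ)) ^ k * ((((F.P K).L : ℝ)) ^ (K - n))⁻¹) ^ 2) with hαj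
  have hL0 : (0 : ℝ) < ((F.P K).L : ℝ) := by exact_mod_cast lt_of_lt_of_le (by norm_num) (F.P K).hL.2
  have hDpos : 0 < 1024 * (((F.P K).d : ℝ) + 1) * (((F.P K).d : ℝ) + 4) * ((F.P K).L : ℝ) ^ 2 := by positivity
  have hsmallj : 512 * ((F.P K).d + 1) * ((F.P K).d + 4) * ((F.P K).L : ℝ) ^ 2 * αj ≤ 1 := by
    have h1 : 512 * (((F.P K).d : ℝ) + 1) * (((F.P K).d : ℝ) + 4) * ((F.P K).L : ℝ) ^ 2 * αj
        ≤ 512 * (((F.P K).d : ℝ) + 1) * (((F.P K).d : ℝ) + 4) * ((F.P K).L : ℝ) ^ 2 * (1 / (1024 * (((F.P K).d : ℝ) + 1) * (((F.P K).d : ℝ) + 4) * ((F.P K).L : ℝ) ^ 2)) :=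
      mul_le_mul_of_nonneg_left hαjle (by positivity)
    have h2 : 512 * (((F.P K).d : ℝ) + 1) * (((F.P K).d : ℝ) + 4) * ((F.P K).L : ℝ) ^ 2 * (1 / (1024 * (((F.P K).d : ℝ) + 1) * (((F.P K).d : ℝ) + 4) * ((F.P K).L : ℝ) ^ 2))
        = 1 / 2 := by
      field_simp; ring
    linarith
  have h44 : ∀ (x : LSite (F.P K).d) (κ κ' : Fin (F.P K).d), κ ≠ κ' →
      ‖((hol (avgIter (F.P K).L (pull (bgUnits F K W) (basePt F n K)) k) x (plaqWord κ κ') : (Matrix (Fin 2) (Fin 2) ℂ)ˣ) : Matrix (Fin 2) (Fin 2) ℂ) - 1‖ ≤ αj :=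
    fun x κ κ' _ => (le_pdev hV x κ κ').trans hpdev.le
  exact norm_Wcx_sub_one_le (F.P K).L hL1 (avgIter (F.P K).L (pull (bgUnits F K W) (basePt F n K)) k) hV hαj0 hsmallj h44 q κ r

/-- `α_k ≤ 1∕64` — the same loop bound as a WINDOW (for `hα24`∕`hα8`-type hypotheses; = ★routeR-w2 ✓`norm_Wcx_avgIter_sub_one_le_of_regPr`'s number). [cite: Balaban1985Averaging, (47) p.25] -/
theorem alpha_level_le_window {ε₀ : ℝ} (hε₀ : 0 < ε₀) (hε : 10 ^ 7 * (F.L : ℝ) ^ 3 * ε₀ ≤ 1)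
    (W : GaugeField (F.P K) 0 (Matrix.specialUnitaryGroup (Fin 2) ℂ)) (hreg : RegPr F n K ε₀ W) {k : ℕ} (hk : k ≤ K - n) :
    2 * (8 * ((F.P K).d + 1) * ((F.P K).d + 4) * ((F.P K).L : ℝ) ^ 2 * (2 * (2 * ε₀ * ((((F.P K).L : ℝ)) ^ k * ((((F.P K).L : ℝ)) ^ (K - n))⁻¹) ^ 2))) ≤ 1 / 64 := by
  obtain ⟨-, -, -, hαjle⟩ := level_data_of_regPr F hε₀ hε W hreg hk
  have hL0 : (0 : ℝ) < ((F.P K).L : ℝ) := by exact_mod_cast lt_of_lt_of_le (by norm_num) (F.P K).hL.2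
  have hDpos : 0 < 1024 * (((F.P K).d : ℝ) + 1) * (((F.P K).d : ℝ) + 4) * ((F.P K).L : ℝ) ^ 2 := by positivity
  have h1 : 2 * (8 * ((F.P K).d + 1) * ((F.P K).d + 4) * ((F.P K).L : ℝ) ^ 2 * (2 * (2 * ε₀ * ((((F.P K).L : ℝ)) ^ k * ((((F.P K).L : ℝ)) ^ (K - n))⁻¹) ^ 2)))
      ≤ 2 * (8 * (((F.P K).d : ℝ) + 1) * (((F.P K).d : ℝ) + 4) * ((F.P K).L : ℝ) ^ 2 * (1 / (1024 * (((F.P K).d : ℝ) + 1) * (((F.P K).d : ℝ) + 4) * ((F.P K).L : ℝ) ^ 2))) :=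
    mul_le_mul_of_nonneg_left (mul_le_mul_of_nonneg_left hαjle (by positivity)) (by norm_num)
  have h2 : 2 * (8 * (((F.P K).d : ℝ) + 1) * (((F.P K).d : ℝ) + 4) * ((F.P K).L : ℝ) ^ 2 * (1 / (1024 * (((F.P K).d : ℝ) + 1) * (((F.P K).d : ℝ) + 4) * ((F.P K).L : ℝ) ^ 2)))
      = 1 / 64 := by
    field_simp; ring
  linarith

/-- ★ **`hbs k` — THE NEXT-LEVEL BOND AGAINST THE STRAIGHT SEGMENT, PROPORTIONAL TO `a_k`**: for `k + 1 ≤ K − n`,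
`‖Ū₀♯ᵏ⁺¹(z,ν) − Ū₀♯ᵏ([L•z, L•z + L e_ν])‖ ≤ 4·α_k` (✓F-6c-2a `norm_rescale_bavg_sub_hol_seg_le` with the loop coefficient of this file; lit `avgIter_succ`).
[cite: Balaban1985Averaging, (43) p.24, (47) p.25, (65) p.29] -/
theorem norm_avgIter_succ_pull_sub_hol_seg_le_of_regPr {ε₀ : ℝ} (hε₀ : 0 < ε₀) (hε : 10 ^ 7 * (F.L : ℝ) ^ 3 * ε₀ ≤ 1)
    (W : GaugeField (F.P K) 0 (Matrix.specialUnitaryGroup (Fin 2) ℂ)) (hreg : RegPr F n K ε₀ W) {k : ℕ} (hk : k ≤ K - n)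
    (z : LSite (F.P K).d) (ν : Fin (F.P K).d) :
    ‖((avgIter (F.P K).L (pull (bgUnits F K W) (basePt F n K)) (k + 1) z ν : (Matrix (Fin 2) (Fin 2) ℂ)ˣ) : Matrix (Fin 2) (Fin 2) ℂ)
        - ((hol (avgIter (F.P K).L (pull (bgUnits F K W) (basePt F n K)) k) ((((F.P K).L : ℕ) : ℤ) • z) (seg ν (((F.P K).L : ℕ) : ℤ)) :
            (Matrix (Fin 2) (Fin 2) ℂ)ˣ) : Matrix (Fin 2) (Fin 2) ℂ)‖
      ≤ 4 * (2 * (8 * ((F.P K).d + 1) * ((F.P K).d + 4) * ((F.P K).L : ℝ) ^ 2 * (2 * (2 * ε₀ * ((((F.P K).L : ℝ)) ^ k * ((((F.P K).L : ℝ)) ^ (K - n))⁻¹) ^ 2)))) := by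
  obtain ⟨hV, -, -, -⟩ := level_data_of_regPr F hε₀ hε W hreg hk
  haveI : NeZero (F.P K).L := ⟨by have := (F.P K).hL.2; omega⟩
  have hα8 : 2 * (8 * (((F.P K).d : ℝ) + 1) * (((F.P K).d : ℝ) + 4) * ((F.P K).L : ℝ) ^ 2 * (2 * (2 * ε₀ * ((((F.P K).L : ℝ)) ^ k * ((((F.P K).L : ℝ)) ^ (K - n))⁻¹) ^ 2))) ≤ 1 / 8 :=
    (alpha_level_le_window F hε₀ hε W hreg hk).trans (by norm_num)
  rw [avgIter_succ, rescale_apply]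
  exact norm_rescale_bavg_sub_hol_seg_le (F.P K).L hV (norm_Wcx_avgIter_pull_sub_one_le_level_of_regPr F hε₀ hε W hreg hk) hα8 z ν

/-- ★ **`hbU` — THE AVERAGED BOND IS IN `U1`**: `bavg L Ū₀♯ᵏ (L•z) κ ∈ U1` for `k + 1 ≤ K − n` (= ✓`avgIter_pull_mem_U1_of_regPr` one level up, read through lit `avgIter_succ`).
[cite: Balaban1985Averaging, (43) p.24, (52)–(54) p.26] -/
theorem bavg_avgIter_pull_mem_U1_of_regPr {ε₀ : ℝ} (hε₀ : 0 < ε₀) (hε : 10 ^ 7 * (F.L : ℝ) ^ 3 * ε₀ ≤ 1)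
    (W : GaugeField (F.P K) 0 (Matrix.specialUnitaryGroup (Fin 2) ℂ)) (hreg : RegPr F n K ε₀ W) {k : ℕ} (hk : k + 1 ≤ K - n)
    (z : LSite (F.P K).d) (κ : Fin (F.P K).d) :
    bavg (F.P K).L (avgIter (F.P K).L (pull (bgUnits F K W) (basePt F n K)) k) ((((F.P K).L : ℕ) : ℤ) • z) κ ∈ U1 (Matrix (Fin 2) (Fin 2) ℂ) := by
  have h := avgIter_pull_mem_U1_of_regPr F hε₀ hε W hreg hk z κ
  rw [avgIter_succ, rescale_apply] at h
  exact h

/-! ## Appendix (v2): the tower is SPECIAL-UNITARY-valued (F-7b's `hV : … ∈ unitaryUnits`; ★routeR-w4 g16 10:23:43Z letter note) -/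

open B7Prop2Explicit (avgIter_mem unitaryUnits)
open B7Prop2SpecialUnitary (specialUnitaryUnits specialUnitaryUnits_le_unitaryUnits)

/-- ★ **`Ū₀♯ᵏ` IS `SU(2)`-VALUED** for `k ≤ K − n`: lit ✓`B7Prop2Explicit.avgIter_mem` on the averaging-closed subgroup `specialUnitaryUnits (Fin 2)`
(✓`avgClosed_specialUnitary_of_le_twentyone`) from the member's tower data (✓`tower_data_of_regPr`, ✓`windows_of_ten7`). [cite: Balaban1985Averaging, (52)–(54) p.26] -/
theorem avgIter_pull_mem_specialUnitaryUnits_of_regPr {ε₀ : ℝ} (hε₀ : 0 < ε₀) (hε : 10 ^ 7 * (F.L : ℝ) ^ 3 * ε₀ ≤ 1)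
    (W : GaugeField (F.P K) 0 (Matrix.specialUnitaryGroup (Fin 2) ℂ)) (hreg : RegPr F n K ε₀ W) {k : ℕ} (hk : k ≤ K - n)
    (x : LSite (F.P K).d) (κ : Fin (F.P K).d) :
    avgIter (F.P K).L (pull (bgUnits F K W) (basePt F n K)) k x κ ∈ specialUnitaryUnits (Fin 2) := by
  obtain ⟨hα3, hα4, -, -, -⟩ := windows_of_ten7 F (K := K) hε₀.le hε
  have hL2 : 2 ≤ (F.P K).L := (F.P K).hL.2
  obtain ⟨hU₀, h52⟩ := tower_data_of_regPr hε₀ W hreg (le_refl (K - n))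
  have hG := avgClosed_specialUnitary_of_le_twentyone (N := 2) (by norm_num) (F.P K).d (F.P K).L
  have hα : 0 < 2 * ε₀ := by positivity
  have hα2 : 2 * (2 * ε₀) ≤ B7Prop2Explicit.c2' (F.P K).d (F.P K).L := by linarith
  exact avgIter_mem (F.P K).L hL2 hG (K - n) (pull (bgUnits F K W) (basePt F n K)) hU₀ hα hα3 hα2 h52 k hk x κ

/-- … hence UNITARY-valued (`unitaryUnits`: the `hV` letter of ✓F-5a∕F-5b∕F-5c, ✓cov-2 and F-7b — `bavg` unitarity, `conjR` isometry both ways).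
[cite: Balaban1985Averaging, (52)–(54) p.26] -/
theorem avgIter_pull_mem_unitaryUnits_of_regPr {ε₀ : ℝ} (hε₀ : 0 < ε₀) (hε : 10 ^ 7 * (F.L : ℝ) ^ 3 * ε₀ ≤ 1)
    (W : GaugeField (F.P K) 0 (Matrix.specialUnitaryGroup (Fin 2) ℂ)) (hreg : RegPr F n K ε₀ W) {k : ℕ} (hk : k ≤ K - n)
    (x : LSite (F.P K).d) (κ : Fin (F.P K).d) :
    avgIter (F.P K).L (pull (bgUnits F K W) (basePt F n K)) k x κ ∈ unitaryUnits (Matrix (Fin 2) (Fin 2) ℂ) :=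
  specialUnitaryUnits_le_unitaryUnits (avgIter_pull_mem_specialUnitaryUnits_of_regPr F hε₀ hε W hreg hk x κ)

end Summit.QuantumFields.YangMills.Theorems.Prop7CombTowerWindowsOfRegPr
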